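import Literature.GroupTheory.Coxeter.GramMatrixSpectrumBipartite
import Literature.GroupTheory.Coxeter.CoxeterElementCharpolyCyclotomic
import Literature.GroupTheory.Coxeter.ExceptionalTypesPositiveDefinite
import Literature.GroupTheory.Coxeter.FiniteTypeB
import Literature.GroupTheory.Coxeter.FiniteTypeD
import Mathlib.RingTheory.RootsOfUnity.Complex
import HarnessLib

/-!
# Eigenvalues `1 + cos(πm/h)` of the Gram matrices of the finite Coxeter groups, `m` an exponent: types `B_n`, `D_n`, `E₆`, `E₇`, `E₈`, `F₄`, `G₂`, `H₃` (Coxeter's cosine formula applied to the known characteristic polynomials)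

Layer `Literature/GroupTheory/Coxeter`, namespace `Literature.GroupTheory.Coxeter`; lane `lit-hodgefound` (Track 2 foundations library; prover seat p18,
generation 55, thirteenth file — over `GramMatrixSpectrumBipartite` (`χ_c(e^{2iθ}) = 0 ⟺ χ_A(1 + cos θ) = 0` for the bipartite Coxeter element),
`CoxeterElementCharpolyConjugacy` (`charpoly_wordProd_eq_of_finite`, `charpoly_wordProd_typeB/D/H₃/F₄`), `CoxeterElementCharpolyCyclotomic`
(`χ_{E₆} = Φ₃Φ₁₂`, `χ_{E₇} = Φ₂Φ₁₈`, `χ_{E₈} = Φ₃₀`, `χ_{F₄} = Φ₁₂`, `χ_{G₂} = Φ₆`), `ExceptionalTypesPositiveDefinite` ∕ `FiniteTypeB` ∕ `FiniteTypeD` (finiteness),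
`BipartiteCoxeterElements` (`exists_colouring_of_finite`) and Mathlib's `Complex.isPrimitiveRoot_exp_of_coprime`, `Polynomial.isRoot_cyclotomic_iff`, `Real.cos_pi_div_five`).

Humphreys §3.7 Table 1 (p. 59) lists the exponents `m_1, …, m_n` and Coxeter numbers `h`; §3.16–3.19: the eigenvalues of a Coxeter element are `e^{2πi m_j/h}`.  By Coxeter's
cosine formula (`aeval_cexp_charpoly_bipartite_eq_zero_iff_gram`, Stekolshchik Proposition 3.1 (1)) each exponent `m` makes `1 + cos(πm/h)` an eigenvalue of the Gram
matrix `A = (−cos(π/m(s,t)))` — the Cartan matrix `2A` has eigenvalues `2 + 2cos(πm_j/h)`, equivalently (`m ↦ h − m`) `4sin²(πm_j/2h)`.  With the characteristic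
polynomials already in the tree this file records the resulting spectra, as statements about the real matrices `gram M` alone:

* §1 the transfer for a finite Coxeter system and ANY Coxeter element (`isRoot_charpoly_gram_one_add_cos_iff_aeval_cexp`); root computations: primitive roots of unity
  and cyclotomic polynomials (`aeval_cexp_cyclotomic_eq_zero`), `e^{iπk/n}` for odd `k` and `X^n + 1` (`aeval_cexp_X_pow_add_one_eq_zero`);
* §2 ★★ `B_n`: `1 + cos(πk/2n)`, `k` odd (`isRoot_charpoly_gram_typeB`); ★★ `D_n`: `1 + cos(πk/(2n−2))`, `k` odd or `k = n − 1` (`isRoot_charpoly_gram_typeD`);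
* §3 ★★ `E₈`: `1 + cos(πm/30)`, `gcd(m,30) = 1`; `E₇`: `1 + cos(πm/18)`, `gcd(m,18) = 1` or `m = 9`; `E₆`: `1 + cos(πm/12)`, `gcd(m,12) = 1` or `m ∈ {4, 8}`; `F₄`:
  `1 + cos(πm/12)`, `gcd(m,12) = 1`; `G₂`: `1 + cos(πm/6)`, `gcd(m, 6) = 1` (`isRoot_charpoly_gram_typeE₈/E₇/E₆/F₄/G₂`);
* §4 ★★ `H₃`: `1 + cos(π/10)`, `1`, `1 − cos(π/10)` (`isRoot_charpoly_gram_typeH₃`, exponents `1, 5, 9`, `φ = 2cos(π/5)`).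

PROVED theorems only (no definition, no named fact, no `sorry`: net debt 0); no instance, no notation.  NOT formalised: `H₄` (its `χ` is stated in the tree with `√5`
and identifying which primitive 30th roots belong to it needs a sign computation), `I₂(p)` (rank two, direct), multiplicities ∕ completeness of the lists (they are
complete by a dimension count, not carried out).

## Source, verbatim

J. E. Humphreys, *Reflection Groups and Coxeter Groups* (1990) [Humphreys1990], §3.7 Table 1 p. 59 (exponents: `A_n: 1, 2, …, n`; `B_n: 1, 3, …, 2n−1`; `D_n: 1, 3, …,
2n−3, n−1`; `E₆: 1, 4, 5, 7, 8, 11`; `E₇: 1, 5, 7, 9, 11, 13, 17`; `E₈: 1, 7, 11, 13, 17, 19, 23, 29`; `F₄: 1, 5, 7, 11`; `G₂: 1, 5`; `H₃: 1, 5, 9`; `H₄: 1, 11, 19, 29`;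
`I₂(m): 1, m−1`), §3.16 p. 75 («these eigenvalues are of the form `ζ^m`»), §3.19 Theorem p. 80.  R. Stekolshchik [Stekolshchik2008], Ch. 3 Proposition 3.1 (1)
(«`(λ+1)²/(4λ) = (γ−1)²`»).

## Proof notes

Each statement: instantiate the universal Coxeter system `M.toCoxeterSystem` (finite by the tree's `finite_of_type_X`), transfer through §1, insert the tree's `χ`, and
check that `e^{2πim/h}` is a root — for cyclotomic factors via `IsPrimitiveRoot`, for `X^n + 1` via `e^{iπk} = −1` (`k` odd).
-/

namespace Literature.GroupTheory.Coxeter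

open Polynomial Complex
open scoped Matrix Real

/-! ### §1 Transfer and root computations -/

section Transfer

variable {B : Type*} [Fintype B] [DecidableEq B] {M : CoxeterMatrix B} {W : Type*} [Group W] (cs : CoxeterSystem M W)

/-- ★ **Coxeter's cosine formula for a finite Coxeter system and ANY Coxeter element `π l`: `1 + cos θ` is an eigenvalue of `A` iff `χ_{π l}(e^{2iθ}) = 0`.**
[cite: Stekolshchik2008, Ch. 3 Proposition 3.1 (1)] [cite: Humphreys1990, §3.16 Proposition pp. 74–75, §3.19 Theorem p. 80] -/
theorem isRoot_charpoly_gram_one_add_cos_iff_aeval_cexp [Finite W] {l : List B} (hl : l.Nodup) (hls : ∀ i, i ∈ l) (θ : ℝ) :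
    (gram M).charpoly.IsRoot (1 + Real.cos θ) ↔ aeval (cexp (2 * θ * I)) (LinearMap.toMatrix' (geomRep cs (cs.wordProd l))).charpoly = 0 := by
  obtain ⟨f, hf⟩ := exists_colouring_of_finite cs
  have hly : ∀ i, i ∈ l.filter (fun i ↦ f i) ↔ f i = true := fun i ↦ by
    rw [List.mem_filter]; exact ⟨fun h ↦ h.2, fun h ↦ ⟨hls i, h⟩⟩
  have hlz : ∀ i, i ∈ l.filter (fun i ↦ !f i) ↔ f i = false := fun i ↦ by
    rw [List.mem_filter]
    constructor
    · intro h; cases hfi : f i <;> simp_all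
    · intro h; exact ⟨hls i, by simp [h]⟩
  have hnd : (l.filter (fun i ↦ f i)).Nodup := hl.filter _
  have hnd' : (l.filter (fun i ↦ !f i)).Nodup := hl.filter _
  rw [← aeval_cexp_charpoly_bipartite_eq_zero_iff_gram cs f hf hly hlz hnd hnd' θ, ← CoxeterSystem.wordProd_append,
    charpoly_wordProd_eq_of_finite cs hl hls (nodup_append_of_colouring f hly hlz hnd hnd') (mem_append_of_colouring f hly hlz)]

/-- `e^{2πim/n}` with `gcd(m, n) = 1` is a root of the `n`-th cyclotomic polynomial. [folklore] [cite: Humphreys1990, §3.20 Proposition p. 82] -/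
theorem aeval_cexp_cyclotomic_eq_zero {n m : ℕ} (hn : n ≠ 0) (hcop : m.Coprime n) : aeval (cexp (2 * ((π * m / n : ℝ) : ℂ) * I)) (cyclotomic n ℝ) = 0 := by
  have hprim := Complex.isPrimitiveRoot_exp_of_coprime m n hn hcop
  have harg : 2 * ((π * m / n : ℝ) : ℂ) * I = 2 * π * I * (m / n) := by push_cast; ring
  haveI : NeZero (n : ℂ) := ⟨Nat.cast_ne_zero.mpr hn⟩
  rw [harg, Polynomial.aeval_def, Polynomial.eval₂_eq_eval_map, Polynomial.map_cyclotomic, ← Polynomial.IsRoot.def, Polynomial.isRoot_cyclotomic_iff]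
  exact hprim

/-- `e^{iπk/n}`, `k` odd, is a root of `X^n + 1` (`n ≠ 0`). [folklore] [cite: Humphreys1990, §3.7 Table 1 p. 59 (exponents of `B_n`: `1, 3, …, 2n − 1`)] -/
theorem aeval_cexp_X_pow_add_one_eq_zero {n k : ℕ} (hn : n ≠ 0) (hk : Odd k) :
    aeval (cexp (2 * ((π * k / (2 * n) : ℝ) : ℂ) * I)) ((X : ℝ[X]) ^ n + 1) = 0 := by
  rw [map_add, map_pow, aeval_X, map_one, ← Complex.exp_nat_mul]
  have harg : (n : ℂ) * (2 * ((π * k / (2 * n) : ℝ) : ℂ) * I) = k * (π * I) := by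
    push_cast
    field_simp
  rw [harg, Complex.exp_nat_mul, Complex.exp_pi_mul_I, hk.neg_one_pow, neg_add_cancel]

end Transfer

/-! ### §2 Types `B_n` and `D_n` -/

section ClassicalTypes

/-- ★★ **`B_n` (`n = m + 1`, `h = 2n`, exponents the odd numbers `< 2n`): `1 + cos(πk/2n)` is an eigenvalue of the Gram matrix for every odd `k`.** [cite: Humphreys1990,
§3.7 Table 1 p. 59, §3.19 Theorem p. 80] [cite: Stekolshchik2008, Ch. 3 Proposition 3.1 (1)] -/
theorem isRoot_charpoly_gram_typeB {m k : ℕ} (hk : Odd k) : (gram (CoxeterMatrix.B (m + 1))).charpoly.IsRoot (1 + Real.cos (π * k / (2 * (m + 1)))) := by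
  set cs := (CoxeterMatrix.B (m + 1)).toCoxeterSystem
  haveI := finite_of_type_B cs
  rw [isRoot_charpoly_gram_one_add_cos_iff_aeval_cexp cs (List.nodup_finRange (m + 1)) List.mem_finRange,
    charpoly_wordProd_typeB cs (List.nodup_finRange (m + 1)) List.mem_finRange]
  have h := aeval_cexp_X_pow_add_one_eq_zero (n := m + 1) (Nat.succ_ne_zero m) hk
  push_cast at h ⊢
  exact h

/-- ★★ **`D_n` (`n = m + 2`, `h = 2n − 2`, exponents the odd numbers `< 2n − 2` and `n − 1`): `1 + cos(πk/(2n−2))` is an eigenvalue of the Gram matrix for every odd `k`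
and for `k = n − 1`.** [cite: Humphreys1990, §3.7 Table 1 p. 59, §3.19 Theorem p. 80] [cite: Stekolshchik2008, Ch. 3 Proposition 3.1 (1)] -/
theorem isRoot_charpoly_gram_typeD {m k : ℕ} (hk : Odd k ∨ k = m + 1) : (gram (coxeterMatrixD (m + 2))).charpoly.IsRoot (1 + Real.cos (π * k / (2 * (m + 1)))) := by
  set cs := (coxeterMatrixD (m + 2)).toCoxeterSystem
  haveI := finite_of_type_D cs
  rw [isRoot_charpoly_gram_one_add_cos_iff_aeval_cexp cs (List.nodup_finRange (m + 2)) List.mem_finRange,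
    charpoly_wordProd_typeD cs (List.nodup_finRange (m + 2)) List.mem_finRange, map_mul, mul_eq_zero]
  rcases hk with hk | rfl
  · right
    have h := aeval_cexp_X_pow_add_one_eq_zero (n := m + 1) (Nat.succ_ne_zero m) hk
    push_cast at h ⊢
    exact h
  · left
    rw [map_add, aeval_X, map_one]
    have harg : 2 * (((π * (m + 1 : ℕ) / (2 * (m + 1))) : ℝ) : ℂ) * I = π * I := by
      push_cast
      field_simp
    push_cast at harg ⊢
    rw [harg, Complex.exp_pi_mul_I, neg_add_cancel]

end ClassicalTypes

/-! ### §3 Types `E₆`, `E₇`, `E₈`, `F₄`, `G₂` (cyclotomic characteristic polynomials) -/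

section ExceptionalTypes

/-- ★★ **`E₈` (`h = 30`, exponents `1, 7, 11, 13, 17, 19, 23, 29`): `1 + cos(πm/30)` is an eigenvalue of the Gram matrix whenever `gcd(m, 30) = 1`.** [cite: Humphreys1990,
§3.7 Table 1 p. 59, §3.20 pp. 81–82] [cite: Stekolshchik2008, Ch. 3 Proposition 3.1 (1)] -/
theorem isRoot_charpoly_gram_typeE₈ {m : ℕ} (hm : m.Coprime 30) : (gram CoxeterMatrix.E₈).charpoly.IsRoot (1 + Real.cos (π * m / 30)) := by
  set cs := CoxeterMatrix.E₈.toCoxeterSystem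
  haveI := finite_of_type_E₈ cs
  rw [isRoot_charpoly_gram_one_add_cos_iff_aeval_cexp cs (List.nodup_finRange 8) List.mem_finRange, charpoly_coxeterElement_typeE₈_eq_cyclotomic cs]
  exact_mod_cast aeval_cexp_cyclotomic_eq_zero (n := 30) (by norm_num) hm

/-- ★★ **`F₄` (`h = 12`, exponents `1, 5, 7, 11`): `1 + cos(πm/12)` is an eigenvalue whenever `gcd(m, 12) = 1`.** [cite: Humphreys1990, §3.7 Table 1 p. 59, §3.20
pp. 81–82] [cite: Stekolshchik2008, Ch. 3 Proposition 3.1 (1)] -/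
theorem isRoot_charpoly_gram_typeF₄ {m : ℕ} (hm : m.Coprime 12) : (gram CoxeterMatrix.F₄).charpoly.IsRoot (1 + Real.cos (π * m / 12)) := by
  set cs := CoxeterMatrix.F₄.toCoxeterSystem
  haveI := finite_of_type_F₄ cs
  rw [isRoot_charpoly_gram_one_add_cos_iff_aeval_cexp cs (List.nodup_finRange 4) List.mem_finRange, charpoly_coxeterElement_typeF₄_eq_cyclotomic cs]
  exact_mod_cast aeval_cexp_cyclotomic_eq_zero (n := 12) (by norm_num) hm

/-- ★★ **`G₂` (`h = 6`, exponents `1, 5`): `1 + cos(πm/6)` is an eigenvalue whenever `gcd(m, 6) = 1`.** [cite: Humphreys1990, §3.7 Table 1 p. 59] [cite: Stekolshchik2008,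
Ch. 3 Proposition 3.1 (1)] -/
theorem isRoot_charpoly_gram_typeG₂ {m : ℕ} (hm : m.Coprime 6) : (gram CoxeterMatrix.G₂).charpoly.IsRoot (1 + Real.cos (π * m / 6)) := by
  set cs := CoxeterMatrix.G₂.toCoxeterSystem
  haveI := finite_of_type_G₂ cs
  rw [isRoot_charpoly_gram_one_add_cos_iff_aeval_cexp cs (List.nodup_finRange 2) List.mem_finRange, charpoly_coxeterElement_typeG₂_eq_cyclotomic cs]
  exact_mod_cast aeval_cexp_cyclotomic_eq_zero (n := 6) (by norm_num) hm

/-- ★★ **`E₇` (`h = 18`, exponents `1, 5, 7, 9, 11, 13, 17`): `1 + cos(πm/18)` is an eigenvalue whenever `gcd(m, 18) = 1` or `m = 9`** (`χ = Φ₂Φ₁₈`; `m = 9` gives the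
eigenvalue `1`). [cite: Humphreys1990, §3.7 Table 1 p. 59, §3.20 pp. 81–82] [cite: Stekolshchik2008, Ch. 3 Proposition 3.1 (1)] -/
theorem isRoot_charpoly_gram_typeE₇ {m : ℕ} (hm : m.Coprime 18 ∨ m = 9) : (gram CoxeterMatrix.E₇).charpoly.IsRoot (1 + Real.cos (π * m / 18)) := by
  set cs := CoxeterMatrix.E₇.toCoxeterSystem
  haveI := finite_of_type_E₇ cs
  rw [isRoot_charpoly_gram_one_add_cos_iff_aeval_cexp cs (List.nodup_finRange 7) List.mem_finRange, charpoly_coxeterElement_typeE₇_eq_cyclotomic cs, map_mul,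
    mul_eq_zero]
  rcases hm with hm | rfl
  · right
    exact_mod_cast aeval_cexp_cyclotomic_eq_zero (n := 18) (by norm_num) hm
  · left
    have h := aeval_cexp_cyclotomic_eq_zero (n := 2) (m := 1) (by norm_num) (Nat.coprime_one_left 2)
    have harg : ((π * (1 : ℕ) / (2 : ℕ) : ℝ) : ℂ) = ((π * (9 : ℕ) / 18 : ℝ) : ℂ) := by push_cast; ring
    rwa [harg] at h

/-- ★★ **`E₆` (`h = 12`, exponents `1, 4, 5, 7, 8, 11`): `1 + cos(πm/12)` is an eigenvalue whenever `gcd(m, 12) = 1` or `m ∈ {4, 8}`** (`χ = Φ₃Φ₁₂`). [cite: Humphreys1990,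
§3.7 Table 1 p. 59, §3.20 pp. 81–82] [cite: Stekolshchik2008, Ch. 3 Proposition 3.1 (1)] -/
theorem isRoot_charpoly_gram_typeE₆ {m : ℕ} (hm : m.Coprime 12 ∨ m = 4 ∨ m = 8) : (gram CoxeterMatrix.E₆).charpoly.IsRoot (1 + Real.cos (π * m / 12)) := by
  set cs := CoxeterMatrix.E₆.toCoxeterSystem
  haveI := finite_of_type_E₆ cs
  rw [isRoot_charpoly_gram_one_add_cos_iff_aeval_cexp cs (List.nodup_finRange 6) List.mem_finRange, charpoly_coxeterElement_typeE₆_eq_cyclotomic cs, map_mul,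
    mul_eq_zero]
  rcases hm with hm | rfl | rfl
  · right
    exact_mod_cast aeval_cexp_cyclotomic_eq_zero (n := 12) (by norm_num) hm
  · left
    have h := aeval_cexp_cyclotomic_eq_zero (n := 3) (m := 1) (by norm_num) (Nat.coprime_one_left 3)
    have harg : ((π * (1 : ℕ) / (3 : ℕ) : ℝ) : ℂ) = ((π * (4 : ℕ) / 12 : ℝ) : ℂ) := by push_cast; ring
    rwa [harg] at h
  · left
    have h := aeval_cexp_cyclotomic_eq_zero (n := 3) (m := 2) (by norm_num) (by norm_num)
    have harg : ((π * (2 : ℕ) / (3 : ℕ) : ℝ) : ℂ) = ((π * (8 : ℕ) / 12 : ℝ) : ℂ) := by push_cast; ring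
    rwa [harg] at h

end ExceptionalTypes

/-! ### §4 Type `H₃` -/

section TypeH

/-- ★★ **`H₃` (`h = 10`, exponents `1, 5, 9`; `χ = (X + 1)(X² − φX + 1)`, `φ = 2cos(π/5)`): the Gram matrix has the eigenvalues `1 + cos(π/10)`, `1` and `1 − cos(π/10)`.**
[cite: Humphreys1990, §3.7 Table 1 p. 59, §2.13 p. 47] [cite: Stekolshchik2008, Ch. 3 Proposition 3.1 (1)] -/
theorem isRoot_charpoly_gram_typeH₃ :
    (gram CoxeterMatrix.H₃).charpoly.IsRoot (1 + Real.cos (π / 10)) ∧ (gram CoxeterMatrix.H₃).charpoly.IsRoot 1 ∧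
      (gram CoxeterMatrix.H₃).charpoly.IsRoot (1 - Real.cos (π / 10)) := by
  set cs := CoxeterMatrix.H₃.toCoxeterSystem
  haveI := finite_of_type_H₃ cs
  have hφ : (1 + √5) / 2 = 2 * Real.cos (π / 5) := by rw [Real.cos_pi_div_five]; ring
  -- `e^{iπ/5}` is a root of `X² − 2cos(π/5) X + 1`, `−1` of `X + 1`
  have h1 : (gram CoxeterMatrix.H₃).charpoly.IsRoot (1 + Real.cos (π / 10)) := by
    rw [isRoot_charpoly_gram_one_add_cos_iff_aeval_cexp cs (List.nodup_finRange 3) List.mem_finRange,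
      charpoly_wordProd_typeH₃ cs (List.nodup_finRange 3) List.mem_finRange, hφ, map_mul, mul_eq_zero]
    right
    have harg : 2 * ((π / 10 : ℝ) : ℂ) * I = ((π / 5 : ℝ) : ℂ) * I := by push_cast; ring
    rw [map_add, map_sub, map_pow, map_mul, aeval_X, aeval_C, map_one, harg, Complex.coe_algebraMap, Complex.ofReal_mul, Complex.ofReal_ofNat, Complex.ofReal_cos,
      Complex.two_cos]
    have hu : cexp (((π / 5 : ℝ) : ℂ) * I) ≠ 0 := Complex.exp_ne_zero _
    rw [show -(((π / 5 : ℝ) : ℂ)) * I = -((((π / 5 : ℝ) : ℂ)) * I) by ring, Complex.exp_neg]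
    field_simp
    ring
  have h5 : (gram CoxeterMatrix.H₃).charpoly.IsRoot 1 := by
    have h := (isRoot_charpoly_gram_one_add_cos_iff_aeval_cexp cs (List.nodup_finRange 3) List.mem_finRange (π / 2)).2 ?_
    · rwa [Real.cos_pi_div_two, add_zero] at h
    rw [charpoly_wordProd_typeH₃ cs (List.nodup_finRange 3) List.mem_finRange, map_mul, mul_eq_zero]
    left
    rw [map_add, aeval_X, map_one, show 2 * ((π / 2 : ℝ) : ℂ) * I = π * I by push_cast; ring, Complex.exp_pi_mul_I, neg_add_cancel]
  refine ⟨h1, h5, ?_⟩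
  rw [show (1 : ℝ) - Real.cos (π / 10) = 2 - (1 + Real.cos (π / 10)) by ring, isRoot_charpoly_gram_two_sub_iff _ twoColouring_typeFGH.2.2.1]
  exact h1

end TypeH

end Literature.GroupTheory.Coxeter
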